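/-
Copyright (c) 2026 the pub-hodgecm-mathlib formalisation cell (harness21).  Prover seat hodgecm-mathlib-F0P3a-p01 (g18): road «S3-ram», (Cnt2′) ROUTE B, chair F0P3a-p07 (g15)
RULING (16)(c) ∕ (17) — THE RESIDUAL DATA OF THE HYPERBOLIC ROOT BLOCK (regimes A-odd ∕ C) and the NULL COUNT ON THE RESIDUAL CONIC, 2026-09-02.
-/
import Literature.NumberTheory.Rogawski1990.DepthZeroKappaTransferTypeTwoRamifiedRootValueLines      -- ★ p849383 (this seat): the lattice → conic junction; brings ★ G3⁗, `quadraticChar_residue_eq_neg_one_of_forall`, `residue_eq_zero_iff_v_lt_one`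
import Literature.NumberTheory.Rogawski1990.DepthZeroKappaTransferTypeTwoRamifiedDepthParity         -- ★ (B-p14 lineage): `TypeTwoRamifiedDepth.not_isSquare_trace_sq_sub_four_det_of_not_exists_isRoot`
import Literature.NumberTheory.Automorphic.UnitaryGroupRankOneBigCell                                -- ★ `UnitaryGroup.antidiagonal_three_over_eq` (`J₀ = !![0,0,1;0,1,0;1,0,0]`)
import Literature.NumberTheory.Automorphic.UnitaryLatticeTreeRootStarCountOfInvolution               -- ★ `natCard_conicParams_eq` (`#{2b + a² = 0} = q`)
import HarnessLib

/-!
# The hyperbolic root block at odd depth: residual symmetry, residual irreducibility, the value gap, and the null count on the conic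

Generic local algebra for the (Cnt2′) route-B hyperbolic cells in regimes A-odd ∕ C ([Rogawski1990] §4.9; [Kottwitz1986] §3).  Data: a valued field `K` with
involution `σ` (`σϖ = −ϖ`, residually trivial), a block `B₀ ∈ U(σ, !![0,1;1,0])` (the re-rooted centred W-block of the hyperbolic literal `Γ = ι(B₀, 1)`) with
`B₀ ≡ 1 (mod ϖ^m)`, `m` ODD, and its integral leading matrix `Y = (ϖ^m)⁻¹(B₀ − 1) ∈ M₂(𝒪)`, residual matrix `Ȳ`.

* §1 (finite field `k`, `char k ≠ 2`).  `natCard_null_add_natCard_quadraticChar_eq` — the three fibres `{Q = 0} ⊔ {χ(cQ) = 1} ⊔ {χ(cQ) = −1}` of any function exhaust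
  the `q + 1` conic points.  `natCard_conicNull_of_iotaShape` — for an `ι`-shaped residual matrix `Ȳ' = ι(Ȳ, 0)` with `Ȳ₀₀ = Ȳ₁₁` and `χ(Ȳ₀₁Ȳ₁₀) = −1` (irreducible
  residual block) the NULL count `#{p : ᵗx_p(J₀Ȳ')x_p = 0}` is `2` if `χ(det Ȳ) = 1` and `0` if `χ(det Ȳ) = −1` (the chart `a ↦ (1, a, −a²∕2)` turns it into
  `#{a : (Ȳ₀₁a² − 2Ȳ₀₀)² = 4 det Ȳ}`; the two square classes `a² = u_±` have `χ(u₊)χ(u₋) = χ(Ȳ₀₁Ȳ₁₀) = −1`).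
* §2 (valued `K`).  `v_leading_diag_sub_lt_one` — unitarity of `B₀` for the hyperbolic plane at ODD depth forces `Ȳ₁₁ = Ȳ₀₀` (the `(0,1)` entry of
  `ᵗσ(B₀)HB₀ = H`, `σ(ϖ^m) = −ϖ^m`); `forall_v_sq_sub_four_mul_eq_one` — irreducibility of `χ_{B₀}` with `|disc B₀| = |ϖ|^{2m}` makes `4Ȳ₀₁Ȳ₁₀` (the residual
  discriminant of `Ȳ`) a NON-SQUARE UNIT (Hensel through `hsq`); `v_det_sub_smul_one_eq_of_leading` — hence the VALUE GAP `|det(B₀ − t·1)| = |ϖ|^{2m}` for every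
  `t ≡ 1 (mod ϖ^m)` (the `hχ` binder of ★ `rootSlices_hyperbolic_of_lineCounts`); residual forms `residue_leading_diag_eq`, `quadraticChar_residue_leading_offDiag_eq_neg_one`.

References: [cite: Rogawski1990, §4.9 Prop. 4.9.1 (b) p. 55, Lemma 4.9.3 p. 56]; [cite: Kottwitz1986, §3]; [cite: LabesseLanglands1979, §2 Lemma 2.1];
[cite: IrelandRosen1990, Ch. 8 §1] (quadratic characters, `#{x² = a} = 1 + χ(a)`); [cite: Serre1979, Ch. II §4 Prop. 7] (Hensel for squares).
-/

set_option autoImplicit false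

open scoped Valued WithZero Matrix MatrixGroups
open Finset Matrix
open Literature.NumberTheory.Automorphic Literature.NumberTheory.Automorphic.HermitianLattice Literature.NumberTheory.Automorphic.UnitaryLatticeTree
open Literature.NumberTheory.Rogawski1990.TypeTwoRamifiedDepth

namespace Literature.NumberTheory.Rogawski1990.TypeOneRamifiedJunction

/-! ## §1 Finite-field bookkeeping on the residual conic -/

section Finite

variable {k : Type*} [Field k] [Fintype k] [DecidableEq k]

/-- **TRICHOTOMY ON A FINITE TYPE**: for `c ≠ 0` the fibres `{Q = 0}`, `{χ(cQ) = 1}`, `{χ(cQ) = −1}` of any `Q : X → k` partition `X`. [cite: IrelandRosen1990, Ch. 8 §1] -/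
theorem natCard_null_add_natCard_quadraticChar_eq {X : Type*} [Fintype X] (Q : X → k) {c : k} (hc : c ≠ 0) :
    Nat.card {x : X // Q x = 0} + Nat.card {x : X // quadraticChar k (c * Q x) = 1} + Nat.card {x : X // quadraticChar k (c * Q x) = -1} =
      Fintype.card X := by
  classical
  rw [Nat.card_eq_fintype_card, Nat.card_eq_fintype_card, Nat.card_eq_fintype_card, Fintype.card_subtype, Fintype.card_subtype, Fintype.card_subtype]
  have hunion : (univ.filter fun x : X => quadraticChar k (c * Q x) = 1) ∪ (univ.filter fun x : X => quadraticChar k (c * Q x) = -1) =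
      univ.filter fun x : X => ¬ Q x = 0 := by
    ext x
    simp only [Finset.mem_union, Finset.mem_filter, Finset.mem_univ, true_and]
    constructor
    · rintro (h | h) h0 <;> rw [h0, mul_zero, MulChar.map_zero] at h <;> norm_num at h
    · exact fun h0 => quadraticChar_dichotomy (mul_ne_zero hc h0)
  have hdisj : Disjoint (univ.filter fun x : X => quadraticChar k (c * Q x) = 1) (univ.filter fun x : X => quadraticChar k (c * Q x) = -1) :=
    Finset.disjoint_filter.2 fun x _ h1 h2 => by rw [h1] at h2; norm_num at h2
  rw [add_assoc, ← Finset.card_union_of_disjoint hdisj, hunion, Finset.card_filter_add_card_filter_not, Finset.card_univ]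

/-- **TRICHOTOMY ON THE RESIDUAL CONIC** (`2 ≠ 0`): the three fibres of `Q` on `{∞} ⊔ {(a,b) : 2b + a² = 0}` have total size `q + 1` (★ `natCard_conicParams_eq`).
[cite: IrelandRosen1990, Ch. 8 §1] [cite: BruhatTits1972, §10] -/
theorem natCard_conic_null_add_quadraticChar_eq (h2 : (2 : k) ≠ 0)
    (Q : Option {p : k × k // p.2 + (RingHom.id k) p.2 + p.1 * (RingHom.id k) p.1 = 0} → k) {c : k} (hc : c ≠ 0) :
    Nat.card {x // Q x = 0} + Nat.card {x // quadraticChar k (c * Q x) = 1} + Nat.card {x // quadraticChar k (c * Q x) = -1} = Nat.card k + 1 := by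
  rw [natCard_null_add_natCard_quadraticChar_eq Q hc, Fintype.card_option, ← Nat.card_eq_fintype_card, natCard_conicParams_eq h2]

/-- `#{a : a² = u} = χ(u) + 1` in `Nat.card` currency (★ Mathlib `quadraticChar_card_sqrts`). [cite: IrelandRosen1990, Ch. 8 §1] -/
theorem natCard_sq_eq_eq (hk : ringChar k ≠ 2) (u : k) : (Nat.card {a : k // a ^ 2 = u} : ℤ) = quadraticChar k u + 1 := by
  rw [← quadraticChar_card_sqrts hk u, Nat.card_eq_fintype_card, Fintype.card_subtype, Set.toFinset_setOf]

/-- The square classes `u₊ ≠ u₋` with `χ(u₊u₋) = −1` carry together exactly TWO square roots. [cite: IrelandRosen1990, Ch. 8 §1] -/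
theorem natCard_sq_eq_or_eq_two (hk : ringChar k ≠ 2) {u₁ u₂ : k} (hne : u₁ ≠ u₂) (hprod : quadraticChar k (u₁ * u₂) = -1) :
    Nat.card {a : k // a ^ 2 = u₁ ∨ a ^ 2 = u₂} = 2 := by
  classical
  have h₁0 : u₁ ≠ 0 := fun h => by rw [h, zero_mul, MulChar.map_zero] at hprod; norm_num at hprod
  have h₂0 : u₂ ≠ 0 := fun h => by rw [h, mul_zero, MulChar.map_zero] at hprod; norm_num at hprod
  have hsum : quadraticChar k u₁ + quadraticChar k u₂ = 0 := by
    rw [map_mul] at hprod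
    rcases quadraticChar_dichotomy h₁0 with h | h <;> rcases quadraticChar_dichotomy h₂0 with h' | h' <;> rw [h, h'] at hprod ⊢ <;> omega
  have hcard : (Nat.card {a : k // a ^ 2 = u₁ ∨ a ^ 2 = u₂} : ℤ) = Nat.card {a : k // a ^ 2 = u₁} + Nat.card {a : k // a ^ 2 = u₂} := by
    rw [Nat.card_eq_fintype_card, Nat.card_eq_fintype_card, Nat.card_eq_fintype_card, Fintype.card_subtype, Fintype.card_subtype, Fintype.card_subtype,
      Finset.filter_or, Finset.card_union_of_disjoint (Finset.disjoint_filter.2 fun a _ h1 h2 => hne (h1.symm.trans h2))]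
    push_cast; rfl
  have h := natCard_sq_eq_eq hk u₁
  have h' := natCard_sq_eq_eq hk u₂
  have e : (Nat.card {a : k // a ^ 2 = u₁ ∨ a ^ 2 = u₂} : ℤ) = 2 := by rw [hcard, h, h']; linear_combination hsum
  exact_mod_cast e

set_option maxHeartbeats 800000 in
/-- **THE NULL COUNT ON THE CONIC FOR AN `ι`-SHAPED RESIDUAL MATRIX WITH IRREDUCIBLE BLOCK.**  `Ȳ' ∈ M₃(k)` with `Ȳ'_{01} = Ȳ'_{10} = Ȳ'_{11} = Ȳ'_{12} = Ȳ'_{21} = 0`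
(the shape of `(ϖ^m)⁻¹(ι(B₀,1) − 1)`), equal corner diagonal `Ȳ'_{22} = Ȳ'_{00}` (unitarity at odd depth, §2) and `χ(Ȳ'_{02}Ȳ'_{20}) = −1` (irreducible residual
block, §2).  The value on the chart is `Q(x_∞) = Ȳ'_{02}`, `Q(x_{(a,b)}) = Ȳ'_{20} + 2Ȳ'_{00}b + Ȳ'_{02}b²`, `b = −a²∕2`, and `#{p : Q(x_p) = 0} = #{a : (Ȳ'_{02}a² − 2Ȳ'_{00})² = 4D}`,
`D = Ȳ'_{00}² − Ȳ'_{02}Ȳ'_{20}` the block determinant: **`2` null points if `χ(D) = 1`, none if `χ(D) = −1`** (the hyperbolic root's `νE ∈ {2, 0}`, FAV∕UNF).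
[cite: Rogawski1990, §4.9 Prop. 4.9.1 (b) p. 55] [cite: Kottwitz1986, §3] [cite: IrelandRosen1990, Ch. 8 §1] -/
theorem natCard_conicNull_of_iotaShape (hk : ringChar k ≠ 2) (Y : Matrix (Fin 3) (Fin 3) k)
    (h01 : Y 0 1 = 0) (h10 : Y 1 0 = 0) (h11 : Y 1 1 = 0) (h12 : Y 1 2 = 0) (h21 : Y 2 1 = 0)
    (hdiag : Y 2 2 = Y 0 0) (hirr : quadraticChar k (Y 0 2 * Y 2 0) = -1) :
    (quadraticChar k (Y 0 0 ^ 2 - Y 0 2 * Y 2 0) = 1 →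
      Nat.card {p : Option {p : k × k // p.2 + (RingHom.id k) p.2 + p.1 * (RingHom.id k) p.1 = 0} //
        (p.elim (Pi.single 2 1) fun q => ![(1 : k), q.1.1, q.1.2]) ⬝ᵥ
          ((((StdForm.antidiagonal 3).over k) * Y) *ᵥ (p.elim (Pi.single 2 1) fun q => ![(1 : k), q.1.1, q.1.2])) = 0} = 2) ∧
    (quadraticChar k (Y 0 0 ^ 2 - Y 0 2 * Y 2 0) = -1 →
      Nat.card {p : Option {p : k × k // p.2 + (RingHom.id k) p.2 + p.1 * (RingHom.id k) p.1 = 0} //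
        (p.elim (Pi.single 2 1) fun q => ![(1 : k), q.1.1, q.1.2]) ⬝ᵥ
          ((((StdForm.antidiagonal 3).over k) * Y) *ᵥ (p.elim (Pi.single 2 1) fun q => ![(1 : k), q.1.1, q.1.2])) = 0} = 0) := by
  classical
  have h2 : (2 : k) ≠ 0 := Ring.two_ne_zero hk
  have h4 : (4 : k) ≠ 0 := by rw [show (4 : k) = 2 * 2 by norm_num]; exact mul_ne_zero h2 h2
  have h22 : (2 : k)⁻¹ * 2 = 1 := inv_mul_cancel₀ h2
  have hx0 : Y 2 0 ≠ 0 := fun h => by rw [h, mul_zero, MulChar.map_zero] at hirr; norm_num at hirr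
  have hy0 : Y 0 2 ≠ 0 := fun h => by rw [h, zero_mul, MulChar.map_zero] at hirr; norm_num at hirr
  -- the value on the chart
  have hJ : (StdForm.antidiagonal 3).over k = !![(0 : k), 0, 1; 0, 1, 0; 1, 0, 0] := UnitaryGroup.antidiagonal_three_over_eq
  have hQn : (Pi.single (2 : Fin 3) (1 : k)) ⬝ᵥ ((((StdForm.antidiagonal 3).over k) * Y) *ᵥ (Pi.single 2 1)) = Y 0 2 := by
    rw [hJ]
    simp [Matrix.mulVec, dotProduct, Fin.sum_univ_three, Matrix.mul_apply, Pi.single_apply]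
  have hQs : ∀ a b : k, (![(1 : k), a, b]) ⬝ᵥ ((((StdForm.antidiagonal 3).over k) * Y) *ᵥ ![(1 : k), a, b]) = Y 2 0 + 2 * Y 0 0 * b + Y 0 2 * b ^ 2 := by
    intro a b
    rw [hJ]
    simp [Matrix.mulVec, dotProduct, Fin.sum_univ_three, Matrix.mul_apply, h01, h10, h11, h12, h21, hdiag]
    ring
  -- the chart `a ↦ (1, a, −a²∕2)`: `{Q = 0} ≃ {a : (Ȳ₀₂a² − 2Ȳ₀₀)² = 4D}`
  have hkey : ∀ a : k, Y 2 0 + 2 * Y 0 0 * (-(a ^ 2) * 2⁻¹) + Y 0 2 * (-(a ^ 2) * 2⁻¹) ^ 2 = 0 ↔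
      (Y 0 2 * a ^ 2 - 2 * Y 0 0) ^ 2 = 4 * (Y 0 0 ^ 2 - Y 0 2 * Y 2 0) := by
    intro a
    constructor
    · intro h
      linear_combination (4 * Y 0 2) * h - (-4 * Y 0 0 * Y 0 2 * a ^ 2 + Y 0 2 ^ 2 * a ^ 4 * (2 * 2⁻¹ + 1)) * h22
    · intro h
      have h' : 4 * Y 0 2 * (Y 2 0 + 2 * Y 0 0 * (-(a ^ 2) * 2⁻¹) + Y 0 2 * (-(a ^ 2) * 2⁻¹) ^ 2) = 0 := by
        linear_combination h + (-4 * Y 0 0 * Y 0 2 * a ^ 2 + Y 0 2 ^ 2 * a ^ 4 * (2 * 2⁻¹ + 1)) * h22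
      rcases mul_eq_zero.1 h' with h'' | h''
      · exact absurd h'' (mul_ne_zero h4 hy0)
      · exact h''
  let f : {a : k // (Y 0 2 * a ^ 2 - 2 * Y 0 0) ^ 2 = 4 * (Y 0 0 ^ 2 - Y 0 2 * Y 2 0)} →
      {p : Option {p : k × k // p.2 + (RingHom.id k) p.2 + p.1 * (RingHom.id k) p.1 = 0} //
        (p.elim (Pi.single 2 1) fun q => ![(1 : k), q.1.1, q.1.2]) ⬝ᵥ
          ((((StdForm.antidiagonal 3).over k) * Y) *ᵥ (p.elim (Pi.single 2 1) fun q => ![(1 : k), q.1.1, q.1.2])) = 0} :=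
    fun a => ⟨some ⟨(a.1, -(a.1 ^ 2) * 2⁻¹), by
        show -(a.1 ^ 2) * 2⁻¹ + -(a.1 ^ 2) * 2⁻¹ + a.1 * a.1 = 0
        linear_combination (-(a.1 ^ 2)) * h22⟩, by
        show (![(1 : k), a.1, -(a.1 ^ 2) * 2⁻¹]) ⬝ᵥ ((((StdForm.antidiagonal 3).over k) * Y) *ᵥ ![(1 : k), a.1, -(a.1 ^ 2) * 2⁻¹]) = 0
        rw [hQs]; exact (hkey a.1).2 a.2⟩
  have hf : Function.Bijective f := by
    constructor
    · intro a a' h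
      have h1 := congrArg (fun p => p.1) h
      simp only [f, Option.some.injEq, Subtype.mk.injEq, Prod.mk.injEq] at h1
      exact Subtype.ext h1.1
    · rintro ⟨p, hp⟩
      rcases p with _ | ⟨⟨a, b⟩, hab⟩
      · exact absurd (hQn.symm.trans hp) hy0
      · have hab' : b + b + a * a = 0 := hab
        have hb : b = -(a ^ 2) * 2⁻¹ := by linear_combination (2⁻¹ : k) * hab' - b * h22
        have hp' : (![(1 : k), a, b]) ⬝ᵥ ((((StdForm.antidiagonal 3).over k) * Y) *ᵥ ![(1 : k), a, b]) = 0 := hp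
        rw [hQs, hb] at hp'
        refine ⟨⟨a, (hkey a).1 hp'⟩, Subtype.ext ?_⟩
        simp only [f]
        congr 1
        exact Subtype.ext (Prod.ext rfl hb.symm)
  have hcard := Nat.card_congr (Equiv.ofBijective f hf)
  refine ⟨fun hDsq => ?_, fun hDns => ?_⟩
  · -- `D = r²`, `r ≠ 0`: the two classes `a² = (2Ȳ₀₀ ± 2r)∕Ȳ₀₂`
    have hD0 : Y 0 0 ^ 2 - Y 0 2 * Y 2 0 ≠ 0 := fun h => by rw [h, MulChar.map_zero] at hDsq; norm_num at hDsq
    obtain ⟨r, hr⟩ := (quadraticChar_one_iff_isSquare hD0).1 hDsq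
    have hr0 : r ≠ 0 := fun h => hD0 (by rw [hr, h, mul_zero])
    have hiff : ∀ a : k, (Y 0 2 * a ^ 2 - 2 * Y 0 0) ^ 2 = 4 * (Y 0 0 ^ 2 - Y 0 2 * Y 2 0) ↔
        a ^ 2 = (2 * Y 0 0 + 2 * r) / Y 0 2 ∨ a ^ 2 = (2 * Y 0 0 - 2 * r) / Y 0 2 := by
      intro a
      rw [show 4 * (Y 0 0 ^ 2 - Y 0 2 * Y 2 0) = (2 * r) ^ 2 by rw [hr]; ring, sq_eq_sq_iff_eq_or_eq_neg, eq_div_iff hy0, eq_div_iff hy0]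
      refine or_congr ⟨fun h => ?_, fun h => ?_⟩ ⟨fun h => ?_, fun h => ?_⟩
      · linear_combination h
      · linear_combination h
      · linear_combination h
      · linear_combination h
    have hne : (2 * Y 0 0 + 2 * r) / Y 0 2 ≠ (2 * Y 0 0 - 2 * r) / Y 0 2 := by
      intro h
      rw [div_eq_div_iff hy0 hy0, mul_eq_mul_right_iff, or_iff_left hy0] at h
      have h4r : (4 : k) * r = 0 := by linear_combination h
      exact hr0 ((mul_eq_zero.1 h4r).resolve_left h4)
    have hprod : quadraticChar k ((2 * Y 0 0 + 2 * r) / Y 0 2 * ((2 * Y 0 0 - 2 * r) / Y 0 2)) = -1 := by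
      have e : (2 * Y 0 0 + 2 * r) / Y 0 2 * ((2 * Y 0 0 - 2 * r) / Y 0 2) = (2 / Y 0 2) ^ 2 * (Y 0 2 * Y 2 0) := by
        rw [div_mul_div_comm, div_pow, div_mul_eq_mul_div, div_eq_div_iff (mul_ne_zero hy0 hy0) (pow_ne_zero 2 hy0)]
        linear_combination (4 * Y 0 2 ^ 2) * hr
      rw [e, map_mul, quadraticChar_sq_one' (div_ne_zero h2 hy0), one_mul]; exact hirr
    rw [← hcard, Nat.card_congr (Equiv.subtypeEquivRight hiff), natCard_sq_eq_or_eq_two hk hne hprod]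
  · -- `D` a non-square: no `a`
    rw [← hcard]
    haveI : IsEmpty {a : k // (Y 0 2 * a ^ 2 - 2 * Y 0 0) ^ 2 = 4 * (Y 0 0 ^ 2 - Y 0 2 * Y 2 0)} := ⟨fun ⟨a, ha⟩ =>
      (quadraticChar_neg_one_iff_not_isSquare.1 hDns) ⟨(Y 0 2 * a ^ 2 - 2 * Y 0 0) * 2⁻¹, by
        linear_combination (-(Y 0 0 ^ 2 - Y 0 2 * Y 2 0) * (1 + 2 * 2⁻¹)) * h22 - (2⁻¹ : k) ^ 2 * ha⟩⟩
    exact Nat.card_of_isEmpty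

end Finite

/-! ## §2 The residual data of the W-block `B₀ ∈ U(σ, !![0,1;1,0])`, `B₀ ≡ 1 (mod ϖ^m)`, `m` odd -/

section Valued

variable {K : Type*} [Field K] [Valued K ℤᵐ⁰] {σ : K →+* K} {ϖ : K}

/-- The entries of `B₀` from its leading matrix: `B₀ᵢⱼ = δᵢⱼ + ϖ^m·Yᵢⱼ`. [cite: Kottwitz1986, §3] -/
theorem coe_apply_eq_one_add_of_leading (hϖ0 : ϖ ≠ 0) {B₀ : GL (Fin 2) K} {m : ℕ} (Y : Matrix (Fin 2) (Fin 2) 𝒪[K])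
    (hY : ∀ i j, ((Y i j : 𝒪[K]) : K) = (ϖ ^ m)⁻¹ * (((B₀ : Matrix (Fin 2) (Fin 2) K) - 1) i j)) (i j : Fin 2) :
    (B₀ : Matrix (Fin 2) (Fin 2) K) i j = (1 : Matrix (Fin 2) (Fin 2) K) i j + ϖ ^ m * ((Y i j : 𝒪[K]) : K) := by
  rw [hY, mul_inv_cancel_left₀ (pow_ne_zero _ hϖ0), Matrix.sub_apply]; ring

/-- **UNITARITY AT ODD DEPTH ⇒ EQUAL DIAGONAL RESIDUES**: for `B₀ ∈ U(σ, !![0,1;1,0])` with leading matrix `Y` at ODD depth `m` (`σ(ϖ^m) = −ϖ^m`, `σ` residually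
trivial): `|Y₁₁ − Y₀₀| < 1` — the `(0,1)` entry of `ᵗσ(B₀)·H·B₀ = H` reads `Y₁₁ − σ(Y₀₀) = ϖ^m(σ(Y₀₀)Y₁₁ + σ(Y₁₀)Y₀₁)`.  (Residually `HȲ` is SYMMETRIC.)
[cite: Kottwitz1986, §3] [cite: Rogawski1990, §4.9 p. 55] -/
theorem v_leading_diag_sub_lt_one (hvσ : ∀ a, Valued.v (σ a) = Valued.v a) (hσϖ : σ ϖ = -ϖ) (hϖ : Valued.v ϖ = WithZero.exp (-1 : ℤ))
    (hres : ∀ x : K, Valued.v x ≤ 1 → Valued.v (σ x - x) < 1)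
    {B₀ : GL (Fin 2) K} (hU : B₀ ∈ unitaryGroupOfForm σ (!![(0 : K), 1; 1, 0] : Matrix (Fin 2) (Fin 2) K)) {m : ℕ} (hodd : Odd m)
    (Y : Matrix (Fin 2) (Fin 2) 𝒪[K]) (hY : ∀ i j, ((Y i j : 𝒪[K]) : K) = (ϖ ^ m)⁻¹ * (((B₀ : Matrix (Fin 2) (Fin 2) K) - 1) i j)) :
    Valued.v (((Y 1 1 : 𝒪[K]) : K) - ((Y 0 0 : 𝒪[K]) : K)) < 1 := by
  have hϖ0 : ϖ ≠ 0 := fun h0 => by rw [h0, map_zero] at hϖ; exact WithZero.coe_ne_zero hϖ.symm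
  have hϖlt : Valued.v ϖ < 1 := by rw [hϖ, ← WithZero.exp_zero]; exact WithZero.exp_lt_exp.2 (by norm_num)
  have hB := coe_apply_eq_one_add_of_leading hϖ0 Y hY
  have hσm : σ (ϖ ^ m) = -(ϖ ^ m) := by rw [map_pow, hσϖ, Odd.neg_pow hodd]
  have hU' : ((B₀ : Matrix (Fin 2) (Fin 2) K).map σ)ᵀ * (!![(0 : K), 1; 1, 0] : Matrix (Fin 2) (Fin 2) K) * (B₀ : Matrix (Fin 2) (Fin 2) K) =
      !![(0 : K), 1; 1, 0] := hU
  have h01 : σ ((B₀ : Matrix (Fin 2) (Fin 2) K) 0 0) * (B₀ : Matrix (Fin 2) (Fin 2) K) 1 1 +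
      σ ((B₀ : Matrix (Fin 2) (Fin 2) K) 1 0) * (B₀ : Matrix (Fin 2) (Fin 2) K) 0 1 = 1 := by
    have h := congrFun (congrFun hU' 0) 1
    simp [Matrix.mul_apply, Fin.sum_univ_two] at h
    linear_combination h
  rw [hB 0 0, hB 1 1, hB 1 0, hB 0 1] at h01
  simp only [Matrix.one_apply_eq, Matrix.one_apply_ne (show (1 : Fin 2) ≠ 0 by decide), Matrix.one_apply_ne (show (0 : Fin 2) ≠ 1 by decide),
    map_add, map_mul, map_one, hσm, zero_add] at h01
  -- `Y₁₁ − σ(Y₀₀) = ϖ^m·(σ(Y₀₀)Y₁₁ + σ(Y₁₀)Y₀₁)`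
  have hkey : ((Y 1 1 : 𝒪[K]) : K) - σ ((Y 0 0 : 𝒪[K]) : K) =
      ϖ ^ m * (σ ((Y 0 0 : 𝒪[K]) : K) * ((Y 1 1 : 𝒪[K]) : K) + σ ((Y 1 0 : 𝒪[K]) : K) * ((Y 0 1 : 𝒪[K]) : K)) := by
    have e : ϖ ^ m * ((((Y 1 1 : 𝒪[K]) : K) - σ ((Y 0 0 : 𝒪[K]) : K)) -
        ϖ ^ m * (σ ((Y 0 0 : 𝒪[K]) : K) * ((Y 1 1 : 𝒪[K]) : K) + σ ((Y 1 0 : 𝒪[K]) : K) * ((Y 0 1 : 𝒪[K]) : K))) = 0 := by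
      linear_combination h01
    exact sub_eq_zero.1 ((mul_eq_zero.1 e).resolve_left (pow_ne_zero _ hϖ0))
  have hint : Valued.v (σ ((Y 0 0 : 𝒪[K]) : K) * ((Y 1 1 : 𝒪[K]) : K) + σ ((Y 1 0 : 𝒪[K]) : K) * ((Y 0 1 : 𝒪[K]) : K)) ≤ 1 := by
    refine (Valuation.map_add _ _ _).trans (max_le ?_ ?_)
    · rw [map_mul, hvσ]; exact mul_le_one' (Y 0 0).2 (Y 1 1).2
    · rw [map_mul, hvσ]; exact mul_le_one' (Y 1 0).2 (Y 0 1).2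
  have h1 : Valued.v (((Y 1 1 : 𝒪[K]) : K) - σ ((Y 0 0 : 𝒪[K]) : K)) < 1 := by
    rw [hkey, map_mul, map_pow]
    calc Valued.v ϖ ^ m * Valued.v _ ≤ Valued.v ϖ ^ m * 1 := mul_le_mul' le_rfl hint
      _ < 1 := by rw [mul_one]; exact pow_lt_one₀ zero_le hϖlt (Nat.pos_of_ne_zero hodd.pos.ne').ne'
  have h2 : Valued.v (σ ((Y 0 0 : 𝒪[K]) : K) - ((Y 0 0 : 𝒪[K]) : K)) < 1 := hres _ (Y 0 0).2
  have e : ((Y 1 1 : 𝒪[K]) : K) - ((Y 0 0 : 𝒪[K]) : K) = (((Y 1 1 : 𝒪[K]) : K) - σ ((Y 0 0 : 𝒪[K]) : K)) + (σ ((Y 0 0 : 𝒪[K]) : K) - ((Y 0 0 : 𝒪[K]) : K)) := by ring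
  rw [e]
  exact Valuation.map_add_lt _ h1 h2

/-- Residual form: **`Ȳ₀₀ = Ȳ₁₁`**. [cite: Kottwitz1986, §3] [cite: Rogawski1990, §4.9 p. 55] -/
theorem residue_leading_diag_eq (hvσ : ∀ a, Valued.v (σ a) = Valued.v a) (hσϖ : σ ϖ = -ϖ) (hϖ : Valued.v ϖ = WithZero.exp (-1 : ℤ))
    (hres : ∀ x : K, Valued.v x ≤ 1 → Valued.v (σ x - x) < 1)
    {B₀ : GL (Fin 2) K} (hU : B₀ ∈ unitaryGroupOfForm σ (!![(0 : K), 1; 1, 0] : Matrix (Fin 2) (Fin 2) K)) {m : ℕ} (hodd : Odd m)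
    (Y : Matrix (Fin 2) (Fin 2) 𝒪[K]) (hY : ∀ i j, ((Y i j : 𝒪[K]) : K) = (ϖ ^ m)⁻¹ * (((B₀ : Matrix (Fin 2) (Fin 2) K) - 1) i j)) :
    IsLocalRing.residue 𝒪[K] (Y 0 0) = IsLocalRing.residue 𝒪[K] (Y 1 1) := by
  rw [eq_comm, ← sub_eq_zero, ← map_sub, residue_eq_zero_iff_v_lt_one]
  push_cast
  exact v_leading_diag_sub_lt_one hvσ hσϖ hϖ hres hU hodd Y hY

/-- `tr² − 4det` of `B₀` is `ϖ^{2m}·((Y₀₀ − Y₁₁)² + 4Y₀₁Y₁₀)`. [cite: Kottwitz1986, §3] -/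
theorem trace_sq_sub_four_det_eq_of_leading (hϖ0 : ϖ ≠ 0) {B₀ : GL (Fin 2) K} {m : ℕ} (Y : Matrix (Fin 2) (Fin 2) 𝒪[K])
    (hY : ∀ i j, ((Y i j : 𝒪[K]) : K) = (ϖ ^ m)⁻¹ * (((B₀ : Matrix (Fin 2) (Fin 2) K) - 1) i j)) :
    (B₀ : Matrix (Fin 2) (Fin 2) K).trace ^ 2 - 4 * (B₀ : Matrix (Fin 2) (Fin 2) K).det =
      (ϖ ^ m) ^ 2 * ((((Y 0 0 : 𝒪[K]) : K) - ((Y 1 1 : 𝒪[K]) : K)) ^ 2 + 4 * (((Y 0 1 : 𝒪[K]) : K) * ((Y 1 0 : 𝒪[K]) : K))) := by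
  have hB := coe_apply_eq_one_add_of_leading hϖ0 Y hY
  rw [Matrix.trace_fin_two, Matrix.det_fin_two, hB 0 0, hB 1 1, hB 0 1, hB 1 0]
  simp only [Matrix.one_apply_eq, Matrix.one_apply_ne (show (1 : Fin 2) ≠ 0 by decide), Matrix.one_apply_ne (show (0 : Fin 2) ≠ 1 by decide)]
  ring

/-- **IRREDUCIBILITY ⇒ THE RESIDUAL DISCRIMINANT `4Ȳ₀₁Ȳ₁₀` IS A NON-SQUARE UNIT**: if `χ_{B₀}` has no root in `K`, `|tr² − 4det|(B₀) = |ϖ|^{2m}`, principal units are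
squares (`hsq`) and `|Y₁₁ − Y₀₀| < 1`, then `|z² − 4Y₀₁Y₁₀| = 1` for every integral `z` (the engine's non-square token). [cite: Rogawski1990, §4.9 p. 55]
[cite: Serre1979, Ch. II §4 Prop. 7] [cite: Kottwitz1986, §3] -/
theorem forall_v_sq_sub_four_mul_eq_one (h2 : Valued.v (2 : K) = 1) (hsq : ∀ t : K, Valued.v (t - 1) < 1 → IsSquare t)
    (hϖ : Valued.v ϖ = WithZero.exp (-1 : ℤ)) {B₀ : GL (Fin 2) K}
    (hirr : ¬ ∃ x : K, ((B₀ : Matrix (Fin 2) (Fin 2) K).charpoly).IsRoot x) {m : ℕ}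
    (hdisc : Valued.v ((B₀ : Matrix (Fin 2) (Fin 2) K).trace ^ 2 - 4 * (B₀ : Matrix (Fin 2) (Fin 2) K).det) = Valued.v ϖ ^ (2 * m))
    (Y : Matrix (Fin 2) (Fin 2) 𝒪[K]) (hY : ∀ i j, ((Y i j : 𝒪[K]) : K) = (ϖ ^ m)⁻¹ * (((B₀ : Matrix (Fin 2) (Fin 2) K) - 1) i j))
    (hdiag : Valued.v (((Y 1 1 : 𝒪[K]) : K) - ((Y 0 0 : 𝒪[K]) : K)) < 1) :
    ∀ z : K, Valued.v z ≤ 1 → Valued.v (z ^ 2 - 4 * (((Y 0 1 : 𝒪[K]) : K) * ((Y 1 0 : 𝒪[K]) : K))) = 1 := by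
  have hϖ0 : ϖ ≠ 0 := fun h0 => by rw [h0, map_zero] at hϖ; exact WithZero.coe_ne_zero hϖ.symm
  have h20 : (2 : K) ≠ 0 := fun h0 => by rw [h0, map_zero] at h2; exact zero_ne_one h2
  obtain ⟨Δ, hΔdef⟩ : ∃ Δ : K, Δ = (((Y 0 0 : 𝒪[K]) : K) - ((Y 1 1 : 𝒪[K]) : K)) ^ 2 + 4 * (((Y 0 1 : 𝒪[K]) : K) * ((Y 1 0 : 𝒪[K]) : K)) := ⟨_, rfl⟩
  have hΔ := trace_sq_sub_four_det_eq_of_leading hϖ0 Y hY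
  rw [← hΔdef] at hΔ
  have hvΔ : Valued.v Δ = 1 := by
    have h := hdisc
    rw [hΔ, map_mul, map_pow, map_pow, ← pow_mul, mul_comm m 2] at h
    have hne : Valued.v ϖ ^ (2 * m) ≠ 0 := pow_ne_zero _ ((Valuation.ne_zero_iff _).2 hϖ0)
    calc Valued.v Δ = (Valued.v ϖ ^ (2 * m))⁻¹ * (Valued.v ϖ ^ (2 * m) * Valued.v Δ) := by rw [inv_mul_cancel_left₀ hne]
      _ = 1 := by rw [h, inv_mul_cancel₀ hne]
  have hnsq : ¬ IsSquare Δ := by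
    rintro ⟨d, hd⟩
    refine not_isSquare_trace_sq_sub_four_det_of_not_exists_isRoot h20 _ hirr ⟨ϖ ^ m * d, ?_⟩
    rw [hΔ, hd]; ring
  intro z hz
  have hle : Valued.v (z ^ 2 - 4 * (((Y 0 1 : 𝒪[K]) : K) * ((Y 1 0 : 𝒪[K]) : K))) ≤ 1 := by
    refine (Valuation.map_sub _ _ _).trans (max_le ?_ ?_)
    · rw [map_pow]; exact pow_le_one₀ zero_le hz
    · rw [map_mul, map_mul, show (4 : K) = 2 * 2 by norm_num, map_mul, h2, one_mul, one_mul]; exact mul_le_one' (Y 0 1).2 (Y 1 0).2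
  refine hle.lt_or_eq.resolve_left fun hlt => hnsq ?_
  -- `|Δ − z²| < 1`, so `z` is a unit and `Δ∕z²` a principal unit, hence a square
  have hdz : Valued.v (Δ - z ^ 2) < 1 := by
    have e : Δ - z ^ 2 = (((Y 1 1 : 𝒪[K]) : K) - ((Y 0 0 : 𝒪[K]) : K)) ^ 2 - (z ^ 2 - 4 * (((Y 0 1 : 𝒪[K]) : K) * ((Y 1 0 : 𝒪[K]) : K))) := by
      rw [hΔdef]; ring
    rw [e]
    refine lt_of_le_of_lt (Valuation.map_sub _ _ _) (max_lt ?_ hlt)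
    rw [map_pow]; exact pow_lt_one₀ zero_le hdiag two_ne_zero
  have hvz : Valued.v (z ^ 2) = 1 := by
    have e : z ^ 2 = Δ - (Δ - z ^ 2) := by ring
    rw [e, Valuation.map_sub_eq_of_lt_left _ (by rw [hvΔ]; exact hdz), hvΔ]
  have hz0 : z ^ 2 ≠ 0 := fun h0 => by rw [h0, map_zero] at hvz; exact zero_ne_one hvz
  have hq : Valued.v (Δ / z ^ 2 - 1) < 1 := by
    rw [show Δ / z ^ 2 - 1 = (Δ - z ^ 2) / z ^ 2 by rw [sub_div, div_self hz0], map_div₀, hvz, div_one]; exact hdz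
  obtain ⟨r, hr⟩ := hsq _ hq
  exact ⟨r * z, by rw [show Δ = Δ / z ^ 2 * z ^ 2 by rw [div_mul_cancel₀ _ hz0], hr]; ring⟩

/-- Residual form: **`χ(Ȳ₀₁Ȳ₁₀) = −1`** — the residual characteristic polynomial `(X − Ȳ₀₀)² − Ȳ₀₁Ȳ₁₀` of `Ȳ` is IRREDUCIBLE. [cite: Rogawski1990, §4.9 p. 55]
[cite: IrelandRosen1990, Ch. 8 §1] -/
theorem quadraticChar_residue_leading_offDiag_eq_neg_one [Fintype 𝓀[K]] [DecidableEq 𝓀[K]] (h2 : Valued.v (2 : K) = 1)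
    (hsq : ∀ t : K, Valued.v (t - 1) < 1 → IsSquare t) (hϖ : Valued.v ϖ = WithZero.exp (-1 : ℤ)) {B₀ : GL (Fin 2) K}
    (hirr : ¬ ∃ x : K, ((B₀ : Matrix (Fin 2) (Fin 2) K).charpoly).IsRoot x) {m : ℕ}
    (hdisc : Valued.v ((B₀ : Matrix (Fin 2) (Fin 2) K).trace ^ 2 - 4 * (B₀ : Matrix (Fin 2) (Fin 2) K).det) = Valued.v ϖ ^ (2 * m))
    (Y : Matrix (Fin 2) (Fin 2) 𝒪[K]) (hY : ∀ i j, ((Y i j : 𝒪[K]) : K) = (ϖ ^ m)⁻¹ * (((B₀ : Matrix (Fin 2) (Fin 2) K) - 1) i j))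
    (hdiag : Valued.v (((Y 1 1 : 𝒪[K]) : K) - ((Y 0 0 : 𝒪[K]) : K)) < 1) :
    quadraticChar 𝓀[K] (IsLocalRing.residue 𝒪[K] (Y 0 1) * IsLocalRing.residue 𝒪[K] (Y 1 0)) = -1 := by
  have h4 := forall_v_sq_sub_four_mul_eq_one h2 hsq hϖ hirr hdisc Y hY hdiag
  rw [← map_mul, quadraticChar_neg_one_iff_not_isSquare]
  rintro ⟨r, hr⟩
  obtain ⟨r₀, rfl⟩ := IsLocalRing.residue_surjective r
  rw [← map_mul, ← sub_eq_zero, ← map_sub, residue_eq_zero_iff_v_lt_one] at hr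
  have h := h4 (2 * (r₀ : K)) ((Valuation.map_mul _ _ _).trans_le (by rw [h2, one_mul]; exact r₀.2))
  have e : (2 * (r₀ : K)) ^ 2 - 4 * (((Y 0 1 : 𝒪[K]) : K) * ((Y 1 0 : 𝒪[K]) : K)) = -(2 * 2) * (((Y 0 1 * Y 1 0 - r₀ * r₀ : 𝒪[K]) : 𝒪[K]) : K) := by
    push_cast; ring
  rw [e, Valuation.map_mul, Valuation.map_neg, Valuation.map_mul, h2, one_mul, one_mul] at h
  exact (ne_of_lt hr) h

/-- **THE VALUE GAP `hχ`**: with `|Y₁₁ − Y₀₀| < 1` and the non-square token `|z² − 4Y₀₁Y₁₀| = 1` (all integral `z`), `|det(B₀ − t·1)| = |ϖ|^{2m}` for EVERY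
`t ≡ 1 (mod ϖ^m)`: `det(B₀ − t·1) = ϖ^{2m}·E`, `4E + (Y₀₀ − Y₁₁)² = z² − 4Y₀₁Y₁₀` with `z = Y₀₀ + Y₁₁ − 2τ`, `t = 1 + ϖ^mτ`.  (So `|ϖ|^{2m+1} < |det(B₀ − t·1)|`:
the `hχ` binder of ★ `rootSlices_hyperbolic_of_lineCounts` ∕ `rootRegionPackage_hyperbolic_of_lineCounts`.) [cite: Rogawski1990, §4.9 p. 55] [cite: Kottwitz1986, §3] -/
theorem v_det_sub_smul_one_eq_of_leading (h2 : Valued.v (2 : K) = 1) (hϖ : Valued.v ϖ = WithZero.exp (-1 : ℤ)) {B₀ : GL (Fin 2) K} {m : ℕ}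
    (Y : Matrix (Fin 2) (Fin 2) 𝒪[K]) (hY : ∀ i j, ((Y i j : 𝒪[K]) : K) = (ϖ ^ m)⁻¹ * (((B₀ : Matrix (Fin 2) (Fin 2) K) - 1) i j))
    (hdiag : Valued.v (((Y 1 1 : 𝒪[K]) : K) - ((Y 0 0 : 𝒪[K]) : K)) < 1)
    (h4 : ∀ z : K, Valued.v z ≤ 1 → Valued.v (z ^ 2 - 4 * (((Y 0 1 : 𝒪[K]) : K) * ((Y 1 0 : 𝒪[K]) : K))) = 1) :
    ∀ t : K, Valued.v (t - 1) ≤ Valued.v (ϖ ^ m) →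
      Valued.v (((B₀ : Matrix (Fin 2) (Fin 2) K) - t • (1 : Matrix (Fin 2) (Fin 2) K)).det) = Valued.v ϖ ^ (2 * m) := by
  have hϖ0 : ϖ ≠ 0 := fun h0 => by rw [h0, map_zero] at hϖ; exact WithZero.coe_ne_zero hϖ.symm
  have hpm0 : ϖ ^ m ≠ 0 := pow_ne_zero _ hϖ0
  have hB := coe_apply_eq_one_add_of_leading hϖ0 Y hY
  intro t ht
  set τ : K := (ϖ ^ m)⁻¹ * (t - 1) with hτ
  have hτv : Valued.v τ ≤ 1 := by
    rw [hτ, map_mul, map_inv₀]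
    calc (Valued.v (ϖ ^ m))⁻¹ * Valued.v (t - 1) ≤ (Valued.v (ϖ ^ m))⁻¹ * Valued.v (ϖ ^ m) := mul_le_mul' le_rfl ht
      _ = 1 := inv_mul_cancel₀ ((Valuation.ne_zero_iff _).2 hpm0)
  have htτ : t = 1 + ϖ ^ m * τ := by rw [hτ, mul_inv_cancel_left₀ hpm0]; ring
  set E : K := ((((Y 0 0 : 𝒪[K]) : K) - τ) * (((Y 1 1 : 𝒪[K]) : K) - τ) - ((Y 0 1 : 𝒪[K]) : K) * ((Y 1 0 : 𝒪[K]) : K)) with hE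
  have hdet : ((B₀ : Matrix (Fin 2) (Fin 2) K) - t • (1 : Matrix (Fin 2) (Fin 2) K)).det = (ϖ ^ m) ^ 2 * E := by
    rw [Matrix.det_fin_two]
    simp only [Matrix.sub_apply, Matrix.smul_apply, smul_eq_mul, hB 0 0, hB 1 1, hB 0 1, hB 1 0, Matrix.one_apply_eq,
      Matrix.one_apply_ne (show (1 : Fin 2) ≠ 0 by decide), Matrix.one_apply_ne (show (0 : Fin 2) ≠ 1 by decide), htτ, hE]
    ring
  set z : K := ((Y 0 0 : 𝒪[K]) : K) + ((Y 1 1 : 𝒪[K]) : K) - 2 * τ with hz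
  have hzv : Valued.v z ≤ 1 := by
    refine (Valuation.map_sub _ _ _).trans (max_le ((Valuation.map_add _ _ _).trans (max_le (Y 0 0).2 (Y 1 1).2)) ?_)
    rw [map_mul, h2, one_mul]; exact hτv
  have hid : z ^ 2 - 4 * (((Y 0 1 : 𝒪[K]) : K) * ((Y 1 0 : 𝒪[K]) : K)) = 4 * E + (((Y 1 1 : 𝒪[K]) : K) - ((Y 0 0 : 𝒪[K]) : K)) ^ 2 := by
    rw [hz, hE]; ring
  have hEle : Valued.v E ≤ 1 := by
    refine (Valuation.map_sub _ _ _).trans (max_le ?_ ?_)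
    · rw [map_mul]
      exact mul_le_one' ((Valuation.map_sub _ _ _).trans (max_le (Y 0 0).2 hτv)) ((Valuation.map_sub _ _ _).trans (max_le (Y 1 1).2 hτv))
    · rw [map_mul]; exact mul_le_one' (Y 0 1).2 (Y 1 0).2
  have hE1 : Valued.v E = 1 := by
    refine hEle.lt_or_eq.resolve_left fun hlt => ?_
    have h := h4 z hzv
    rw [hid] at h
    have hlt' : Valued.v (4 * E + (((Y 1 1 : 𝒪[K]) : K) - ((Y 0 0 : 𝒪[K]) : K)) ^ 2) < 1 := by
      refine lt_of_le_of_lt (Valuation.map_add _ _ _) (max_lt ?_ ?_)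
      · rw [map_mul, show (4 : K) = 2 * 2 by norm_num, map_mul, h2, one_mul, one_mul]; exact hlt
      · rw [map_pow]; exact pow_lt_one₀ zero_le hdiag two_ne_zero
    exact (ne_of_lt hlt') h
  rw [hdet, map_mul, map_pow, map_pow, hE1, mul_one, ← pow_mul, mul_comm m 2]

end Valued

end Literature.NumberTheory.Rogawski1990.TypeOneRamifiedJunction
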